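import Mathlib

/-!
# Clamped set integrals are interval integrals (`TangentSkeletonNearStraightL`, stmt-NavierStokesRegularity-23320, registered stub
# `stub_stripPropagation` — glue between Theorems.StadiumPlateauPiece / StadiumConnectorPiece (set integrals over `Icc a b` of clamp-extended data)
# and Theorems.StadiumContourFamily.plateau_connectors_eq (interval integrals), blueprint item R4 of `DIAG-addendum-contour-g2.md`)

`∫_{t ∈ [a,b]} f(clamp t) = ∫_{t ∈ [a,b]} f t = ∫_a^b f` for `a ≤ b` (`setIntegral_clamp_eq`, `setIntegral_Icc_eq_intervalIntegral'`), where
`clamp t = max a (min t b)` is the identity on `[a,b]`.  HONEST FRAMING: bookkeeping for a HYPOTHETICAL filament skeleton on the NEGATIVE side of a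
MODEL route; nothing here bears on Navier–Stokes regularity or blow-up.  `--supports stmt-NavierStokesRegularity-23320`.
-/

set_option linter.dupNamespace false

noncomputable section

namespace Summit.NavierStokesRegularity.NavierStokesRegularity.Theorems.StadiumClampIntegral

open Set MeasureTheory

/-- On `[a,b]` the clamp-extended integrand equals the original one, so the set integrals agree. [folklore] -/
theorem setIntegral_clamp_eq {E : Type*} [NormedAddCommGroup E] [NormedSpace ℝ E] (f : ℝ → E) (a b : ℝ) :
    ∫ t in Icc a b, f (max a (min t b)) = ∫ t in Icc a b, f t := by
  refine setIntegral_congr_fun measurableSet_Icc fun t ht => ?_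
  show f (max a (min t b)) = f t
  rw [min_eq_left ht.2, max_eq_right ht.1]

/-- Set integral over `Icc a b` = interval integral `∫_a^b` (`a ≤ b`). [folklore] -/
theorem setIntegral_Icc_eq_intervalIntegral' {E : Type*} [NormedAddCommGroup E] [NormedSpace ℝ E] (f : ℝ → E) {a b : ℝ}
    (hab : a ≤ b) : ∫ t in Icc a b, f t = ∫ t in a..b, f t := by
  rw [integral_Icc_eq_integral_Ioc, intervalIntegral.integral_of_le hab]

/-- Combined: `∫_{[a,b]} f(clamp t) dt = ∫_a^b f`. [folklore] -/
theorem setIntegral_clamp_eq_intervalIntegral {E : Type*} [NormedAddCommGroup E] [NormedSpace ℝ E] (f : ℝ → E) {a b : ℝ}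
    (hab : a ≤ b) : ∫ t in Icc a b, f (max a (min t b)) = ∫ t in a..b, f t := by
  rw [setIntegral_clamp_eq, setIntegral_Icc_eq_intervalIntegral' f hab]

/-- The reversed orientation (connectors are traversed from `0` to `y`, of either sign): for `b ≤ a`,
`∫_a^b f = −∫_{[b,a]} f(clamp t) dt` with the clamp onto `[b,a]`. [folklore] -/
theorem intervalIntegral_eq_neg_setIntegral_clamp {E : Type*} [NormedAddCommGroup E] [NormedSpace ℝ E] (f : ℝ → E) {a b : ℝ}
    (hba : b ≤ a) : ∫ t in a..b, f t = -∫ t in Icc b a, f (max b (min t a)) := by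
  rw [setIntegral_clamp_eq_intervalIntegral f hba, intervalIntegral.integral_symm]

end Summit.NavierStokesRegularity.NavierStokesRegularity.Theorems.StadiumClampIntegral

end
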